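import Summits.BirchSwinnertonDyer.BirchSwinnertonDyer.Theorems.AlignedTransportAtTwoMainConjectureTransportAlignedAtTwoOrdPlusLineWitnessMinusTable
import HarnessLib

/-!
# Crux C1 `MainConjectureTransportAlignedAtTwo` (stmt-BirchSwinnertonDyer-22296), line `birth`, the `Δ > 0` half (R1) of the promoted residual:
# LEVEL TRANSPORT OF THE TABLE WITNESS (no-go direction) — if the first curve's minus symbols are INTEGRAL at every symmetric cusp of ITS OWN level,
# the depleted minus table is `2`-integral at every symmetric cusp of EVERY admissible level, so the table witness fails (width seat att-p4 g12; `--supports 22296`)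

THEOREMS ONLY (no `def`, no `sorry`, no new named fact). BSD is not proved by this; C1 is not closed by this.

The witness of `…WitnessMinusTable.lamLaw_of_not_padicSquare_of_minusTable_witness` is «`∃ (a b; c a) ∈ Γ₀(N')`, `c ≠ 0`, `1 < ‖Ψ⁻_{W₁}(a/c)‖₂`»,
`Ψ⁻ = eulerDepleteTableList W₁ l [·]⁻_{f₁}`, `N' = q₀N₁N₂∏ℓ²`. A symmetric cusp `a/c` (`a² ≡ 1 (mod c)`) of level `N'` stays symmetric under the depletion
dilations: `ℓ·(a/c) = a/(c/ℓ)`, `ℓ²·(a/c) = a/(c/ℓ²)` (`ℓ² ∣ c`), all of level `N₁`. Hence, by induction over the three-term depletion step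
(`…DepletedPeriodFormula.eulerDepleteTable_eq_three`, weights `1, −a_ℓ/ℓ, 𝟙ℓ⁻¹`, cleared by `ℓ²`):
* §1 **`exists_int_prod_sq_mul_depleteTableList_of_symmetric`** — if `φ(a/c) ∈ ℤ` for every symmetric cusp of level `N₀` (`c ≠ 0`, `N₀ ∣ c`,
  `a² ≡ 1 (mod c)`), then `(∏ℓ²)·(eulerDepleteTableList W l φ)(a/c) ∈ ℤ` for every symmetric cusp of level `N₀∏ℓ²` (any table `φ`, any `W`).
* §2 `exists_gamma0_of_symmetric` (the matrix `(a, (a²−1)/c; c, a) ∈ Γ₀(N₀)`); **`minusSymbol_integral_of_periodFunctional_even`** — the level-`N₁`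
  hypothesis in class currency: if `(2/Ω⁻(f₁))·im{∞,γ∞}_{f₁}` is EVEN for every `γ = (a b; c a) ∈ Γ₀(N₁)` (e.g. when `X₀(N₁)(ℝ)` is connected —
  `N₁` an odd prime power, Snowden 2011 Prop. 1.2.1 with Gross–Harris: every anti-invariant class is `(1−ι)x` — NOT proved here), then `[a/c]⁻_{f₁} ∈ ℤ`
  at every symmetric cusp of level `N₁`.
* §3 **`norm_minusTable_le_one_of_symmetric_integral`** / **`not_minusTable_witness_of_periodFunctional_even`** — under that hypothesis the depleted
  minus table of `W₁` has `‖Ψ⁻(a/c)‖₂ ≤ 1` at every symmetric `γ ∈ Γ₀(N')` of every admissible level: the table witness is IMPOSSIBLE. So the witness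
  route REQUIRES (W2′) «a non-integral minus symbol of `W₁` at a symmetric cusp of level `N₁`» = data ask D-att-p4-2 of
  `Cruxes/…/DELTA-POS-WITNESS-att-p4-g12.md` — now proved NECESSARY.

References: Emerton–Pollack–Weston 2006 §3 (3.4)–(3.5) [EmertonPollackWeston2006]; Greenberg–Vatsal 2000 §1 (8), §3 Rem. 3.4 [GreenbergVatsal2000];
Mazur–Tate–Teitelbaum 1986 §I.8 [MazurTateTeitelbaum1986Invent]; Cremona 1997 §2.1, §2.5, §2.8 [CremonaAlgorithms1997]; Snowden 2011 Prop. 1.2.1.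
-/

noncomputable section

-- justification: the `Summit.BirchSwinnertonDyer.BirchSwinnertonDyer.…` path repeats a component (route-file convention)
set_option linter.dupNamespace false
set_option autoImplicit false

open scoped MatrixGroups ModularForm NumberField Classical
open CongruenceSubgroup Complex WeierstrassCurve IsDedekindDomain Polynomial Module
open Literature.NumberTheory.EllipticCurves Literature.NumberTheory.EllipticCurves.ModularForms
open Literature.NumberTheory.EllipticCurves.Greenberg1999 Literature.NumberTheory.EllipticCurves.GreenbergVatsal2000
open Summit.BirchSwinnertonDyer.BirchSwinnertonDyer.Theorems.AlignedTransportAtTwoDepletedPeriodFormula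
open Summit.BirchSwinnertonDyer.BirchSwinnertonDyer.Theorems.AlignedTransportAtTwoOrdPlusLineOdd
open Summit.BirchSwinnertonDyer.BirchSwinnertonDyer.Theorems.AlignedTransportAtTwoOrdPlusLineWitnessClasses
open Summit.BirchSwinnertonDyer.BirchSwinnertonDyer.Theorems.AlignedTransportAtTwoOrdPlusLineWitnessMinusTable

namespace Summit.BirchSwinnertonDyer.BirchSwinnertonDyer.Theorems.AlignedTransportAtTwoOrdPlusLineWitnessMinusTableLevel

/-! ## §1 Symmetric cusps are stable under the depletion dilations: integrality transports up the level -/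

section Transport

variable (W : WeierstrassCurve ℚ) [W.IsElliptic] [W.IsGloballyMinimal]

/-- `m·(a/c) = a/(c/m)` when `m ∣ c`, `c ≠ 0`. [folklore] -/
theorem natCast_mul_div_eq {m : ℕ} {a c : ℤ} (hm : (m : ℤ) ∣ c) (hm0 : m ≠ 0) (hc : c ≠ 0) :
    (m : ℚ) * ((a : ℚ) / (c : ℚ)) = (a : ℚ) / ((c / m : ℤ) : ℚ) := by
  obtain ⟨k, rfl⟩ := hm
  have hm0i : (m : ℤ) ≠ 0 := by exact_mod_cast hm0
  have hm0' : (m : ℚ) ≠ 0 := by exact_mod_cast hm0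
  have hk0 : (k : ℚ) ≠ 0 := by
    have : k ≠ 0 := fun h ↦ hc (by rw [h, mul_zero])
    exact_mod_cast this
  rw [Int.mul_ediv_cancel_left _ hm0i]
  push_cast
  field_simp

/-- **Integrality of `(∏ℓ²)·Ψ_l` at symmetric cusps transports from level `N₀` to level `N₀∏ℓ²`.** For any table `φ : ℚ → ℚ` with `φ(a/c) ∈ ℤ`
whenever `c ≠ 0`, `N₀ ∣ c`, `a² ≡ 1 (mod c)`, and any duplicate-free list `l` of places: `(∏_{ℓ∈l} ℓ²)·(eulerDepleteTableList W l φ)(a/c) ∈ ℤ`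
whenever `c ≠ 0`, `N₀∏ℓ² ∣ c`, `a² ≡ 1 (mod c)` (three-term step `φ(x) − (a_ℓ/ℓ)φ(ℓx) + 𝟙ℓ⁻¹φ(ℓ²x)` with `ℓx = a/(c/ℓ)`, `ℓ²x = a/(c/ℓ²)`).
[cite: EmertonPollackWeston2006, §3 (3.4)–(3.5)] [cite: GreenbergVatsal2000, §1 (8)] -/
theorem exists_int_prod_sq_mul_depleteTableList_of_symmetric (φ : ℚ → ℚ) (N₀ : ℕ)
    (hφ : ∀ (a c : ℤ), c ≠ 0 → (N₀ : ℤ) ∣ c → a * a ≡ 1 [ZMOD c] → ∃ k : ℤ, φ ((a : ℚ) / c) = k)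
    (l : List (HeightOneSpectrum (𝓞 ℚ))) (hl : l.Nodup) :
    ∀ (a c : ℤ), c ≠ 0 → ((N₀ * ∏ ℓ ∈ (l.map Rat.HeightOneSpectrum.natGenerator).toFinset, ℓ ^ 2 : ℕ) : ℤ) ∣ c → a * a ≡ 1 [ZMOD c] →
      ∃ k : ℤ, ((∏ ℓ ∈ (l.map Rat.HeightOneSpectrum.natGenerator).toFinset, ℓ ^ 2 : ℕ) : ℚ) * eulerDepleteTableList W l φ ((a : ℚ) / c) = k := by
  classical
  induction l with
  | nil =>
    intro a c hc hN ha
    rw [List.map_nil, List.toFinset_nil, Finset.prod_empty, mul_one] at hN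
    obtain ⟨k, hk⟩ := hφ a c hc hN ha
    refine ⟨k, ?_⟩
    rw [List.map_nil, List.toFinset_nil, Finset.prod_empty, Nat.cast_one, one_mul]
    exact hk
  | cons v l ih =>
    intro a c hc hN ha
    have hvl : v ∉ l := (List.nodup_cons.mp hl).1
    have hl' : l.Nodup := (List.nodup_cons.mp hl).2
    set ℓ : ℕ := Rat.HeightOneSpectrum.natGenerator v with hℓ
    have hℓp : ℓ.Prime := Rat.HeightOneSpectrum.prime_natGenerator v
    have hℓ0 : ℓ ≠ 0 := hℓp.ne_zero
    have hℓ0q : (ℓ : ℚ) ≠ 0 := by exact_mod_cast hℓ0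
    set D' : ℕ := ∏ ℓ ∈ (l.map Rat.HeightOneSpectrum.natGenerator).toFinset, ℓ ^ 2 with hD'
    have hnot : ℓ ∉ (l.map Rat.HeightOneSpectrum.natGenerator).toFinset := by
      rw [List.mem_toFinset, List.mem_map]
      rintro ⟨w, hw, hwv⟩
      exact hvl ((Rat.HeightOneSpectrum.primesEquiv.injective (Subtype.ext hwv)) ▸ hw)
    have hDcons : (∏ ℓ ∈ ((v :: l).map Rat.HeightOneSpectrum.natGenerator).toFinset, ℓ ^ 2 : ℕ) = ℓ ^ 2 * D' := by
      rw [List.map_cons, List.toFinset_cons, Finset.prod_insert hnot]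
    rw [hDcons] at hN ⊢
    -- divisibilities: `ℓ² ∣ c`, and `N₀ D' ∣ c/ℓ`, `N₀ D' ∣ c/ℓ²`
    have hℓ0i : (ℓ : ℤ) ≠ 0 := by exact_mod_cast hℓ0
    have hℓ20i : ((ℓ ^ 2 : ℕ) : ℤ) ≠ 0 := by exact_mod_cast pow_ne_zero 2 hℓ0
    have hℓ2c : ((ℓ ^ 2 : ℕ) : ℤ) ∣ c := (Int.natCast_dvd_natCast.mpr (Dvd.intro (N₀ * D') (by ring))).trans hN
    have hℓc : (ℓ : ℤ) ∣ c := (show (ℓ : ℤ) ∣ ((ℓ ^ 2 : ℕ) : ℤ) from ⟨ℓ, by push_cast; ring⟩).trans hℓ2c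
    have hN0 : ((N₀ * D' : ℕ) : ℤ) ∣ c := (Int.natCast_dvd_natCast.mpr ⟨ℓ ^ 2, by ring⟩).trans hN
    obtain ⟨k, hk⟩ := hN
    have hc1 : c / ℓ ≠ 0 := by
      rw [hk]; push_cast
      rw [show (N₀ : ℤ) * ((ℓ : ℤ) ^ 2 * (D' : ℤ)) * k = (ℓ : ℤ) * ((N₀ : ℤ) * (D' : ℤ) * ((ℓ : ℤ) * k)) by ring,
        Int.mul_ediv_cancel_left _ hℓ0i]
      intro h
      apply hc
      rw [hk]; push_cast
      linear_combination (ℓ : ℤ) * h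
    have hc2 : c / (ℓ ^ 2 : ℕ) ≠ 0 := by
      rw [hk]; push_cast
      rw [show (N₀ : ℤ) * ((ℓ : ℤ) ^ 2 * (D' : ℤ)) * k = (ℓ : ℤ) ^ 2 * ((N₀ : ℤ) * (D' : ℤ) * k) by ring,
        Int.mul_ediv_cancel_left _ (pow_ne_zero 2 hℓ0i)]
      intro h
      apply hc
      rw [hk]; push_cast
      linear_combination (ℓ : ℤ) ^ 2 * h
    have hN1 : ((N₀ * D' : ℕ) : ℤ) ∣ c / ℓ := by
      refine ⟨ℓ * k, ?_⟩
      rw [hk]; push_cast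
      rw [show (N₀ : ℤ) * ((ℓ : ℤ) ^ 2 * (D' : ℤ)) * k = (ℓ : ℤ) * ((N₀ : ℤ) * (D' : ℤ) * ((ℓ : ℤ) * k)) by ring,
        Int.mul_ediv_cancel_left _ hℓ0i]
    have hN2 : ((N₀ * D' : ℕ) : ℤ) ∣ c / (ℓ ^ 2 : ℕ) := by
      refine ⟨k, ?_⟩
      rw [hk]; push_cast
      rw [show (N₀ : ℤ) * ((ℓ : ℤ) ^ 2 * (D' : ℤ)) * k = (ℓ : ℤ) ^ 2 * ((N₀ : ℤ) * (D' : ℤ) * k) by ring,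
        Int.mul_ediv_cancel_left _ (pow_ne_zero 2 hℓ0i)]
    have ha1 : a * a ≡ 1 [ZMOD (c / ℓ)] := ha.of_dvd (Int.ediv_dvd_of_dvd hℓc)
    have ha2 : a * a ≡ 1 [ZMOD (c / (ℓ ^ 2 : ℕ))] := ha.of_dvd (Int.ediv_dvd_of_dvd hℓ2c)
    obtain ⟨k₀, hk₀⟩ := ih hl' a c hc hN0 ha
    obtain ⟨k₁, hk₁⟩ := ih hl' a (c / ℓ) hc1 hN1 ha1
    obtain ⟨k₂, hk₂⟩ := ih hl' a (c / (ℓ ^ 2 : ℕ)) hc2 hN2 ha2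
    -- the three-term step
    have hx1 : (ℓ : ℚ) * ((a : ℚ) / c) = (a : ℚ) / ((c / ℓ : ℤ) : ℚ) := natCast_mul_div_eq hℓc hℓ0 hc
    have hx2 : ((ℓ ^ 2 : ℕ) : ℚ) * ((a : ℚ) / c) = (a : ℚ) / ((c / (ℓ ^ 2 : ℕ) : ℤ) : ℚ) :=
      natCast_mul_div_eq hℓ2c (pow_ne_zero 2 hℓ0) hc
    have hℓinv : (ℓ : ℚ) ^ 2 * (ℓ : ℚ)⁻¹ = ℓ := by rw [pow_two, mul_assoc, mul_inv_cancel₀ hℓ0q, mul_one]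
    change ∃ k : ℤ, ((ℓ ^ 2 * D' : ℕ) : ℚ) * eulerDepleteTable W v (eulerDepleteTableList W l φ) ((a : ℚ) / c) = k
    rw [eulerDepleteTable_eq_three, ← hℓ, hx1, hx2]
    refine ⟨(ℓ : ℤ) ^ 2 * k₀ - W.LFunction ℓ * ℓ * k₁ + (if ℓ ∣ W.conductorNorm ℤ then 0 else (ℓ : ℤ) * k₂), ?_⟩
    have e₀ : (D' : ℚ) * eulerDepleteTableList W l φ ((a : ℚ) / c) = k₀ := hk₀
    have e₁ : (D' : ℚ) * eulerDepleteTableList W l φ ((a : ℚ) / ((c / ℓ : ℤ) : ℚ)) = k₁ := hk₁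
    have e₂ : (D' : ℚ) * eulerDepleteTableList W l φ ((a : ℚ) / ((c / (ℓ ^ 2 : ℕ) : ℤ) : ℚ)) = k₂ := hk₂
    split_ifs with hdvd
    · push_cast at e₀ e₁ e₂ ⊢
      linear_combination (ℓ : ℚ) ^ 2 * e₀ - (W.LFunction ℓ : ℚ) * (ℓ : ℚ) * e₁ -
        (W.LFunction ℓ : ℚ) * ((D' : ℚ) * eulerDepleteTableList W l φ ((a : ℚ) / ((c / ℓ : ℤ) : ℚ))) * hℓinv
    · push_cast at e₀ e₁ e₂ ⊢
      linear_combination (ℓ : ℚ) ^ 2 * e₀ - (W.LFunction ℓ : ℚ) * (ℓ : ℚ) * e₁ + (ℓ : ℚ) * e₂ -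
        (W.LFunction ℓ : ℚ) * ((D' : ℚ) * eulerDepleteTableList W l φ ((a : ℚ) / ((c / ℓ : ℤ) : ℚ))) * hℓinv +
        ((D' : ℚ) * eulerDepleteTableList W l φ ((a : ℚ) / ((c / (ℓ : ℤ) ^ 2 : ℤ) : ℚ))) * hℓinv

end Transport

/-! ## §2 The level-`N₁` hypothesis in class currency -/

section Classes

variable {N₀ : ℕ}

/-- The symmetric matrix `(a, (a²−1)/c; c, a) ∈ Γ₀(N₀)` attached to a symmetric cusp `a/c` (`c ≠ 0`, `N₀ ∣ c`, `a² ≡ 1 (mod c)`). [folklore] -/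
theorem exists_gamma0_of_symmetric (a c : ℤ) (hN : (N₀ : ℤ) ∣ c) (ha : a * a ≡ 1 [ZMOD c]) :
    ∃ γ : Gamma0 N₀, (γ : SL(2, ℤ)) 0 0 = a ∧ (γ : SL(2, ℤ)) 1 1 = a ∧ (γ : SL(2, ℤ)) 1 0 = c := by
  obtain ⟨b, hb⟩ := (Int.ModEq.dvd ha.symm : c ∣ a * a - 1)
  let γ : SL(2, ℤ) := ⟨!![a, b; c, a], by rw [Matrix.det_fin_two_of]; linear_combination hb⟩
  have hγ0 : γ ∈ Gamma0 N₀ := by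
    rw [Gamma0_mem]
    show ((c : ℤ) : ZMod N₀) = 0
    obtain ⟨k, rfl⟩ := hN
    push_cast
    rw [ZMod.natCast_self, zero_mul]
  exact ⟨⟨γ, hγ0⟩, rfl, rfl, rfl⟩

variable {W : WeierstrassCurve ℚ} [W.IsElliptic] [W.IsGloballyMinimal] [NeZero (W.conductorNorm ℤ)]
  {f : CuspForm (Gamma0 (W.conductorNorm ℤ)) 2}

omit [W.IsElliptic] [W.IsGloballyMinimal] in
/-- **Even minus functional on every symmetric class of level `N₁` ⇒ integral minus symbols at every symmetric cusp of level `N₁`.** If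
`(2/Ω⁻(f))·im{∞,γ∞}_f` is an even integer for every `γ = (a b; c a) ∈ Γ₀(N_W)` with `c ≠ 0` — e.g. when `X₀(N_W)(ℝ)` is connected, NOT proved here —
then `[a/c]⁻_f ∈ ℤ` whenever `c ≠ 0`, `N_W ∣ c`, `a² ≡ 1 (mod c)` (`im{∞,a/c}_f = Ω⁻_f·[a/c]⁻_f`). [cite: MazurTateTeitelbaum1986Invent, §I.8]
[cite: CremonaAlgorithms1997, §2.1 and §2.5] -/
theorem minusSymbol_integral_of_periodFunctional_even (hf : IsNewformOf W f)
    (heven : ∀ γ : Gamma0 (W.conductorNorm ℤ), (γ : SL(2, ℤ)) 0 0 = (γ : SL(2, ℤ)) 1 1 → (γ : SL(2, ℤ)) 1 0 ≠ 0 →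
      ∃ k : ℤ, (2 / minusPeriod f) * (cuspSymbol f γ).im = 2 * k) :
    ∀ (a c : ℤ), c ≠ 0 → (W.conductorNorm ℤ : ℤ) ∣ c → a * a ≡ 1 [ZMOD c] → ∃ k : ℤ, ratMinusSymbol f ((a : ℚ) / c) = k := by
  intro a c hc hN ha
  obtain ⟨γ, h00, h11, h10⟩ := exists_gamma0_of_symmetric a c hN ha
  obtain ⟨k, hk⟩ := heven γ (h00.trans h11.symm) (h10 ▸ hc)
  have hpos : 0 < minusPeriod f := IsNewform0.minusPeriod_pos_holds hf.1 hf.coeffField_eq_bot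
  rw [cuspSymbol_eq_modularSymbol_of_ne_zero f γ (h10 ▸ hc), h00, h10] at hk
  have him : (modularSymbol f ((a : ℚ) / c)).im = minusPeriod f * (ratMinusSymbol f ((a : ℚ) / c) : ℝ) := by
    have h := im_modularSymbol_eq_minusPeriod_mul hf ((a : ℚ) / c)
    apply Complex.ofReal_injective
    rw [h]; push_cast; ring
  rw [him] at hk
  have e : 2 / minusPeriod f * (minusPeriod f * (ratMinusSymbol f ((a : ℚ) / c) : ℝ)) =
      2 * (ratMinusSymbol f ((a : ℚ) / c) : ℝ) := by
    field_simp
  rw [e] at hk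
  refine ⟨k, ?_⟩
  have : (ratMinusSymbol f ((a : ℚ) / c) : ℝ) = k := by linarith
  exact_mod_cast this

end Classes

/-! ## §3 The table witness is impossible when the first curve's symmetric minus values are even at its own level -/

section NoGo

variable {W : WeierstrassCurve ℚ} [W.IsElliptic] [W.IsGloballyMinimal] [NeZero (W.conductorNorm ℤ)]
  {f : CuspForm (Gamma0 (W.conductorNorm ℤ)) 2}

/-- **`‖Ψ⁻(a/c)‖₂ ≤ 1` at every symmetric `γ = (a b; c a) ∈ Γ₀(N')`, every admissible `N'` (`N_W·∏ℓ² ∣ N'`),** when the minus functional of `f` is even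
on every symmetric class of level `N_W`: §2 + §1 + `‖∏ℓ²‖₂ = 1` (odd primes). [cite: GreenbergVatsal2000, §1 (8)] [cite: MazurTateTeitelbaum1986Invent, §I.8] -/
theorem norm_minusTable_le_one_of_periodFunctional_even (hf : IsNewformOf W f)
    (heven : ∀ γ : Gamma0 (W.conductorNorm ℤ), (γ : SL(2, ℤ)) 0 0 = (γ : SL(2, ℤ)) 1 1 → (γ : SL(2, ℤ)) 1 0 ≠ 0 →
      ∃ k : ℤ, (2 / minusPeriod f) * (cuspSymbol f γ).im = 2 * k)
    (l : List (HeightOneSpectrum (𝓞 ℚ))) (hl : l.Nodup) (hl2 : ∀ v ∈ l, Rat.HeightOneSpectrum.natGenerator v ≠ 2)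
    (N' : ℕ) [NeZero N'] (hNL : W.conductorNorm ℤ * ∏ ℓ ∈ (l.map Rat.HeightOneSpectrum.natGenerator).toFinset, ℓ ^ 2 ∣ N')
    (γ : Gamma0 N') (hγ : (γ : SL(2, ℤ)) 0 0 = (γ : SL(2, ℤ)) 1 1) (hc : (γ : SL(2, ℤ)) 1 0 ≠ 0) :
    ‖((eulerDepleteTableList W l (ratMinusSymbol f) ((((γ : SL(2, ℤ)) 0 0 : ℤ) : ℚ) / (((γ : SL(2, ℤ)) 1 0 : ℤ) : ℚ)) : ℚ) : ℚ_[2])‖ ≤ 1 := by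
  have hSSp : ∀ ℓ ∈ (l.map Rat.HeightOneSpectrum.natGenerator).toFinset, ℓ.Prime := by
    intro ℓ hℓ; rw [List.mem_toFinset, List.mem_map] at hℓ
    obtain ⟨w, -, rfl⟩ := hℓ; exact Rat.HeightOneSpectrum.prime_natGenerator w
  have hSS2 : ∀ ℓ ∈ (l.map Rat.HeightOneSpectrum.natGenerator).toFinset, ℓ ≠ 2 := by
    intro ℓ hℓ; rw [List.mem_toFinset, List.mem_map] at hℓ
    obtain ⟨w, hw, rfl⟩ := hℓ; exact hl2 w hw
  -- `c = γ₁₀` is divisible by `N'`, hence by `N_W·∏ℓ²`; `a² = 1 + bc`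
  have hcN' : (N' : ℤ) ∣ (γ : SL(2, ℤ)) 1 0 := by
    have h := γ.2
    rw [Gamma0_mem] at h
    exact (ZMod.intCast_zmod_eq_zero_iff_dvd _ N').mp h
  have hN : ((W.conductorNorm ℤ * ∏ ℓ ∈ (l.map Rat.HeightOneSpectrum.natGenerator).toFinset, ℓ ^ 2 : ℕ) : ℤ) ∣ (γ : SL(2, ℤ)) 1 0 :=
    (Int.natCast_dvd_natCast.mpr hNL).trans hcN'
  have hdet := Matrix.det_fin_two (γ : SL(2, ℤ)).1
  rw [(γ : SL(2, ℤ)).2] at hdet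
  have h11 : (γ : SL(2, ℤ)) 1 1 = (γ : SL(2, ℤ)) 0 0 := hγ.symm
  rw [h11] at hdet
  have ha : (γ : SL(2, ℤ)) 0 0 * (γ : SL(2, ℤ)) 0 0 ≡ 1 [ZMOD (γ : SL(2, ℤ)) 1 0] :=
    (Int.modEq_iff_dvd.mpr ⟨(γ : SL(2, ℤ)) 0 1, by linear_combination -hdet⟩).symm
  obtain ⟨k, hk⟩ := exists_int_prod_sq_mul_depleteTableList_of_symmetric W (ratMinusSymbol f) (W.conductorNorm ℤ)
    (minusSymbol_integral_of_periodFunctional_even hf heven) l hl _ _ hc hN ha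
  -- `‖D·Ψ‖₂ = ‖Ψ‖₂` and `‖k‖₂ ≤ 1`
  have hD : ‖(((∏ ℓ ∈ (l.map Rat.HeightOneSpectrum.natGenerator).toFinset, ℓ ^ 2 : ℕ)) : ℚ_[2])‖ = 1 :=
    norm_prod_sq_eq_one _ hSSp hSS2
  have hnorm : ‖((eulerDepleteTableList W l (ratMinusSymbol f)
      ((((γ : SL(2, ℤ)) 0 0 : ℤ) : ℚ) / (((γ : SL(2, ℤ)) 1 0 : ℤ) : ℚ)) : ℚ) : ℚ_[2])‖ = ‖((k : ℤ) : ℚ_[2])‖ := by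
    have h := congrArg (fun q : ℚ ↦ ‖(q : ℚ_[2])‖) hk
    rw [Rat.cast_mul, Rat.cast_natCast, Rat.cast_intCast, norm_mul, hD, one_mul] at h
    exact h
  rw [hnorm]
  exact Padic.norm_int_le_one k

/-- **NO-GO FOR THE TABLE WITNESS.** If the minus functional of `f₁` is even on every symmetric class `(a b; c a)` of level `N₁` (e.g. `X₀(N₁)(ℝ)`
connected — `N₁` an odd prime power — NOT proved here), then at every admissible level the witness hypothesis `hII` of
`…WitnessMinusTable.lamLaw_of_not_padicSquare_of_minusTable_witness` is FALSE. Equivalently: that witness REQUIRES a non-integral minus symbol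
`[a/c]⁻_{f₁} ∉ ℤ` at some symmetric cusp of the first curve's own level (data ask D-att-p4-2). [cite: GreenbergVatsal2000, §3 Remark 3.4]
[cite: MazurTateTeitelbaum1986Invent, §I.8] -/
theorem not_minusTable_witness_of_periodFunctional_even (hf : IsNewformOf W f)
    (heven : ∀ γ : Gamma0 (W.conductorNorm ℤ), (γ : SL(2, ℤ)) 0 0 = (γ : SL(2, ℤ)) 1 1 → (γ : SL(2, ℤ)) 1 0 ≠ 0 →
      ∃ k : ℤ, (2 / minusPeriod f) * (cuspSymbol f γ).im = 2 * k)
    (l : List (HeightOneSpectrum (𝓞 ℚ))) (hl : l.Nodup) (hl2 : ∀ v ∈ l, Rat.HeightOneSpectrum.natGenerator v ≠ 2)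
    (N' : ℕ) [NeZero N'] (hNL : W.conductorNorm ℤ * ∏ ℓ ∈ (l.map Rat.HeightOneSpectrum.natGenerator).toFinset, ℓ ^ 2 ∣ N') :
    ¬ ∃ γ : Gamma0 N', (γ : SL(2, ℤ)) 0 0 = (γ : SL(2, ℤ)) 1 1 ∧ (γ : SL(2, ℤ)) 1 0 ≠ 0 ∧
      1 < ‖((eulerDepleteTableList W l (ratMinusSymbol f)
        ((((γ : SL(2, ℤ)) 0 0 : ℤ) : ℚ) / (((γ : SL(2, ℤ)) 1 0 : ℤ) : ℚ)) : ℚ) : ℚ_[2])‖ := by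
  rintro ⟨γ, hγ, hc, hlt⟩
  exact (not_lt.mpr (norm_minusTable_le_one_of_periodFunctional_even hf heven l hl hl2 N' hNL γ hγ hc)) hlt

end NoGo

end Summit.BirchSwinnertonDyer.BirchSwinnertonDyer.Theorems.AlignedTransportAtTwoOrdPlusLineWitnessMinusTableLevel

end
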